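/-
Copyright (c) 2026 the pub-hodgecm-mathlib formalisation cell (harness21).  Prover seat hodgecm-mathlib-LH4-p10 (g9) (valve hand), Track B «K2-LIT»,
#184♮ = hLiu418 = `stmt-HodgeConjecture-24832`; socket #41, KIND W, (KW-arch-hBL) brick (3a)-2 «EXPLICIT (x-a) CHAIN OF RECORD, `Ew` BY VALUE» (architect K2E3-p11 (g10),
assembler K2Liu-p11 (g5) (3c) letter (L1), KW desk F0P2-p08 (g4) word (E) 2026-09-05T01:31:06Z «`hlin` inside (3a)-2»).  The of-record sibling of ★ p863767
`K2LiuKindWArchContinuationGuardedOfRecord.exists_frames_hex_of_std'` with the FORMULA instead of `∃ F`.  THEOREMS ONLY (no `def`, no `instance`, no notation, no named-fact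
hypothesis, no `sorry`, default heartbeats).
-/
import Summits.HodgeConjecture.HodgeConjecture.Theorems.K2LiuKindWArchContinuationGuardedOfRecord   -- ★ p863767 (F0P2-p08): frames preamble, ★ FILE 18, ★ `hex_of_conjugator'` inputs
import Summits.HodgeConjecture.HodgeConjecture.Theorems.K2LiuKindWArchContinuationExplicit          -- ★ p864162 (this seat): `exists_haarRatio_archWhittakerIntegral_eq`
import Summits.HodgeConjecture.HodgeConjecture.Theorems.K2LiuKindWArchWhittakerHolomorphy           -- ★ p864042 (this seat): `norm_cexp_trace_hermOfReal`
import HarnessLib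

/-!
# Crux `HLiu418`, socket #41, KIND W, (3a)-2: THE ARCH WHITTAKER INTEGRAL OF RECORD IS `H^{2(s−s₀)} · Σ_r c_r · (cν(ν) · ∏_w Ew_{r,w}(s))` — EXPLICITLY, AT THE FRAMES OF RECORD

Cell `hodgecm-mathlib`, crux item hLiu418 = `stmt-HodgeConjecture-24832` (helper lane `--supports … --as helper`, count-neutral); KW line, valve hand LH4-p10 (g9).
THE POINT.  ★ p863767 `exists_frames_hex_of_std'` exports the tube frames of record `(T, Tinv, Fr, B, C)` and the ★ FILE 21 conjugator `g` with every frame fact, and then the tail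
`∀ eb, heb → hW → ∀ j S h, det ↑S ≠ 0 → ∃ F, DifferentiableOn ℂ F {0<re} ∧ F = archWhittakerIntegral …` — the VALUE of `F` hidden.  The (KW-arch-hBL) growth letter needs the value, so
THIS FILE re-runs the same road with (a) ★ FILE 18's flat tube presentation `choose`n ONCE into exported data `(m', c, Q)` per summand `j`, (b) the per-`(j, r, S, h, w)` twisted
Whittaker letters as INPUT FUNCTIONS `Ew` (their formula on `{1 < re}`, guarded by `det ↑S ≠ 0`), (c) ★ p864162's ratio function `cν` of the carrier, and concludes the FORMULA
`archWhittakerIntegral (νinf (kindWFinset T₀ ↑S h)) ↑S (FinfT j S h) h_∞ s = H(g⁻¹)^{2(s−s₀)} · Σ_r c j r · (cν (νinf …) · ∏_w Ew j r S h w s)` (`H = modDelta ∘ 𝒦'.pPart ∘ ι`).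
* §1 **`twistedIntegral_finset_sum`** — THE LINEARITY LETTER `hlin` per place (KW desk (E)): for `½ < re s`, finitely many sections `G i ∈ I_w(s, χ_k)` with compact pictures,
  `x = (0 B; C 0) ∈ U(J)`, `g ∈ U(J)` and a hermitian index `hidx` read by `e(b) = e(−tr(hidx·b))`,
  `∫ (Σ_i a_i G_i)(x·n(b)·g)·e(b) db = Σ_i a_i ∫ G_i(x·n(b)·g)·e(b) db` (★ END `integrable_antidiag_transl` × the unimodular weight, `integral_finset_sum`, `integral_const_mul`).
* §2 **`exists_frames_archWhittakerIntegral_eq_of_std`** — THE HEAD: ★ p863767's binders and frame conjuncts VERBATIM, plus `(m', c, Q, cν)`, then the explicit tail (★ p863767's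
  preamble; ★ FILE 18 `exists_flat_tube_presentation`; ★ p864162 `exists_haarRatio_archWhittakerIntegral_eq` at `ν := νinf (kindWFinset T₀ ↑S h)`, `k := −t`, `g₀ := h_∞`, `s₁ := 2∕2`,
  `Cst := H(g⁻¹)^{2(s−s₀)}`, `Gs s r w := ‖j(·,i1)‖^{2(s₀−s)}·F r w`).
References: [Shimura1997, §16.4, §18.4]; [KudlaRallis1994, §1–§2]; [Tan1999, §1, §3]; [BorelJacquet1979, §4.1].
HONEST LABEL.  Count-neutral helper; explicit twin of ★ p863767 — the named analytic inputs of the KIND-W `hex` column are unchanged (`heb`, the guarded per-place letters):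
`HC_CM` is proved only modulo the 7 printed citations (2 remaining named inputs: hLiu418 = `stmt-HodgeConjecture-24832`, h413 = `stmt-HodgeConjecture-24833`) until rung 0 closes.
-/

set_option autoImplicit false
set_option linter.dupNamespace false -- the mandated namespace repeats `HodgeConjecture.HodgeConjecture`

noncomputable section

open Complex Matrix MeasureTheory MeasureTheory.Measure NumberField NumberField.InfinitePlace IsDedekindDomain
open scoped ComplexConjugate NNReal Classical
open Literature.NumberTheory.GaloisRepresentations
open Literature.NumberTheory.Automorphic Literature.NumberTheory.Automorphic.UnitaryGroup
open Literature.NumberTheory.GelbartRogawski1991 Literature.NumberTheory.GelbartRogawski1991.GRConstruction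
open Literature.NumberTheory.GelbartRogawski1991.UnitaryDualPair
open Literature.NumberTheory.K2Lit.SiegelDoubled
open Literature.NumberTheory.ModularForms.SiegelUpperHalfSpace (moeb denom)

namespace Summit.HodgeConjecture.HodgeConjecture.Cruxes.HLiu418.K2LiuKindWArchContinuationExplicitOfRecord

open K2LiuU22CompactPictureDefs K2LiuArchInducedTubeDefs K2LiuSiegelUnipotentLocalDefs K2LiuArchSWSpanningDefs
open K2LiuSiegelUnipotentFourierDefs (skewMatrices unipDeltaChar)
open K2LiuSiegelEisensteinKindWLetters (kindWFinset)
open K2LiuHermitianTubeFrameSign (exists_tubeFrame_arch₄)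
open K2LiuHermitianTubeFrameArch (tw_ne_zero)
open K2LiuArchSiegelCharacterTube (isUnit_det_shimuraFrame)
open K2LiuArchReadingFrame (exists_readingFrame)
open K2LiuArchSiegelCharacterTubeConsumer (tube_eq_of_chart_formula)
open K2LiuArchFrameBridge (kappa_eq)
open K2LiuArchFrameCompactConjugator (exists_frameCompact_conjugator)
open K2LiuKindWArchLetterDefs (archWhittakerIntegral)
open K2LiuArchFlatTubePresentation (exists_flat_tube_presentation)
open K2LiuArchBlockOfFrameEnd (integrable_antidiag_transl)
open K2LiuKindWArchWhittakerHolomorphy (norm_cexp_trace_hermOfReal)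
open K2LiuKindWArchContinuationExplicit (exists_haarRatio_archWhittakerIntegral_eq)

/-! ## §1 The twisted big-cell integral is linear in the section (the `hlin` letter, per place) -/

/-- **LINEARITY OF THE TWISTED INTEGRAL IN THE SECTION** (the per-place `hlin` letter of (3d-ii) ★ `K2LiuKindWArchGrowthKUniform.growth_uniform_of_finite_span`): for
`½ < re s`, finitely many sections `G i ∈ I_w(s, χ_k)` with compact pictures `Q i`, the frame `x = (0 B; C 0) ∈ U(J)`, `g ∈ U(J)`, coefficients `a i`, and a hermitian index `hidx`
with the twist `e(b) = e(−tr(hidx·b))`: the twisted integral of `Σ_i a_i G_i` is `Σ_i a_i` times the twisted integrals (each integrand integrable: ★ END `integrable_antidiag_transl` times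
a continuous weight of modulus `1`, ★ `norm_cexp_trace_hermOfReal`). [cite: Shimura1997, §16.4] [cite: KudlaRallis1994, §1] -/
theorem twistedIntegral_finset_sum {ι : Type*} (Bset : Finset ι) (a : ι → ℂ) (k : ℤ) {s : ℂ} (hs : 1 / 2 < s.re)
    (G : ι → Matrix (Fin 2 ⊕ Fin 2) (Fin 2 ⊕ Fin 2) ℂ → ℂ) (hG : ∀ i ∈ Bset, IsArchSiegelSection (fun z : ℂ => (conj z / ((‖z‖ : ℝ) : ℂ)) ^ k) s (G i))
    (Q : ι → Carrier)
    (hGQ : ∀ i ∈ Bset, ∀ (v : Matrix (Fin 2) (Fin 2) ℂ), vᴴ * v = 1 → ∀ hv : v.det ≠ 0,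
      G i ((2 : ℂ)⁻¹ • fromBlocks (1 + v) (-(I • (1 - v))) (I • (1 - v)) (1 + v) : Matrix (Fin 2 ⊕ Fin 2) (Fin 2 ⊕ Fin 2) ℂ) = evalAt v hv (Q i))
    {B C : Matrix (Fin 2) (Fin 2) ℂ}
    (hx : (fromBlocks 0 B C 0 : Matrix (Fin 2 ⊕ Fin 2) (Fin 2 ⊕ Fin 2) ℂ)ᴴ * Matrix.J (Fin 2) ℂ * (fromBlocks 0 B C 0 : Matrix (Fin 2 ⊕ Fin 2) (Fin 2 ⊕ Fin 2) ℂ) =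
      Matrix.J (Fin 2) ℂ)
    {g : Matrix (Fin 2 ⊕ Fin 2) (Fin 2 ⊕ Fin 2) ℂ} (hg : gᴴ * Matrix.J (Fin 2) ℂ * g = Matrix.J (Fin 2) ℂ)
    {hidx : Matrix (Fin 2) (Fin 2) ℂ} (hh : hidxᴴ = hidx) {eb : Matrix (Fin 2) (Fin 2) ℂ → ℂ}
    (heb : ∀ b : Matrix (Fin 2) (Fin 2) ℂ, eb b = cexp (-(2 * Real.pi * I) * (hidx * b).trace)) :
    ∫ r : Fin 2 → Fin 2 → ℝ, (∑ i ∈ Bset, a i * G i ((fromBlocks 0 B C 0 : Matrix (Fin 2 ⊕ Fin 2) (Fin 2 ⊕ Fin 2) ℂ) * fromBlocks 1 (hermOfReal r) 0 1 * g)) * eb (hermOfReal r) =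
      ∑ i ∈ Bset, a i * ∫ r : Fin 2 → Fin 2 → ℝ, G i ((fromBlocks 0 B C 0 : Matrix (Fin 2 ⊕ Fin 2) (Fin 2 ⊕ Fin 2) ℂ) * fromBlocks 1 (hermOfReal r) 0 1 * g) * eb (hermOfReal r) := by
  -- the weight: continuous, unimodular
  have hfe : eb = fun b => cexp (-(2 * Real.pi * I) * (hidx * b).trace) := funext heb
  have hec : Continuous fun r : Fin 2 → Fin 2 → ℝ => eb (hermOfReal r) := by
    rw [hfe]
    exact Complex.continuous_exp.comp (continuous_const.mul ((continuous_const.matrix_mul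
      K2LiuArchIntertwiningLieDerivativePrelims.continuous_hermOfReal).matrix_trace))
  have he1 : ∀ r : Fin 2 → Fin 2 → ℝ, ‖eb (hermOfReal r)‖ ≤ 1 := fun r => by
    rw [heb, norm_cexp_trace_hermOfReal hh r]
  -- each term is integrable
  have hInt : ∀ i ∈ Bset, Integrable (fun r : Fin 2 → Fin 2 → ℝ =>
      G i ((fromBlocks 0 B C 0 : Matrix (Fin 2 ⊕ Fin 2) (Fin 2 ⊕ Fin 2) ℂ) * fromBlocks 1 (hermOfReal r) 0 1 * g) * eb (hermOfReal r)) := fun i hi =>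
    (integrable_antidiag_transl k hs (hG i hi) (Q i) (hGQ i hi) hx hg).mul_bdd hec.aestronglyMeasurable (Filter.Eventually.of_forall he1)
  have hfun : (fun r : Fin 2 → Fin 2 → ℝ => (∑ i ∈ Bset, a i * G i ((fromBlocks 0 B C 0 : Matrix (Fin 2 ⊕ Fin 2) (Fin 2 ⊕ Fin 2) ℂ) * fromBlocks 1 (hermOfReal r) 0 1 * g)) *
        eb (hermOfReal r)) =
      fun r => ∑ i ∈ Bset, a i * (G i ((fromBlocks 0 B C 0 : Matrix (Fin 2 ⊕ Fin 2) (Fin 2 ⊕ Fin 2) ℂ) * fromBlocks 1 (hermOfReal r) 0 1 * g) * eb (hermOfReal r)) := by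
    funext r
    rw [Finset.sum_mul]
    exact Finset.sum_congr rfl fun i _ => by ring
  rw [hfun, integral_finsetSum _ fun i hi => (hInt i hi).const_mul _]
  exact Finset.sum_congr rfl fun i _ => integral_const_mul _ _

/-! ## §2 The frames of record and the explicit arch Whittaker integral -/

variable (L : Type) [Field L] [NumberField L] [IsCMField L]
variable {N₀ M₀ : ℕ} (e : Fin N₀ × Fin M₀ ≃ Fin 2)
  (dV : Fin N₀ → L) (hdV : ∀ i, IsCMField.complexConj L (dV i) = dV i)
  (dW : Fin M₀ → L) (hdW : ∀ i, IsCMField.complexConj L (dW i) = dW i)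
variable [MeasurableSpace ↥(unipDeltaArch L e dV hdV dW hdW)] [BorelSpace ↥(unipDeltaArch L e dV hdV dW hdW)]

/-- **THE ARCH WHITTAKER INTEGRAL OF RECORD, EXPLICITLY, AT THE FRAMES OF RECORD** (the of-record sibling of ★ p863767 `exists_frames_hex_of_std'`; same binders).  Exported: the
closed-form ★ arch₄ tube frames `T, Tinv`, `Fr`, the anti-diagonal reading `B, C`, the ★ FILE 21 conjugator `g` for the standard datum — with every frame fact of ★ p863767 VERBATIM —
PLUS, per summand `j`, ★ FILE 18's flat tube presentation data `(m' j, c j, Q j)` and ★ p864162's Haar∕Lebesgue ratio `cν` (ONE function of the carrier).  TAIL: for every frame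
reading `eb` of `conj ψ_S(ι_∞ ·)` (`heb`) and every family of per-`(j, r, S, h, w)` twisted Whittaker letters `Ew` BY VALUE (their formula on `{1 < re}` at the point `Fr (h_∞·g) w`,
picture `Q j r w`, weight `−t`, guarded by `det ↑S ≠ 0`):
`det ↑S ≠ 0 → 1 < re s → archWhittakerIntegral (νinf (kindWFinset T₀ ↑S h)) ↑S (FinfT j S h) h_∞ s = H(g⁻¹)^{2(s−s₀)} · Σ_r c j r · (cν (νinf (kindWFinset T₀ ↑S h)) · ∏_w Ew j r S h w s)`,
`H = modDelta ∘ 𝒦'.pPart ∘ ι_∞`.  Proof: ★ p863767's preamble; ★ `exists_flat_tube_presentation` `choose`n per `j`; ★ `exists_haarRatio_archWhittakerIntegral_eq` at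
`ν := νinf (kindWFinset T₀ ↑S h)`, `k := −t`, `g₀ := h_∞`, `s₁ := 2∕2`, `Gs s r w := ‖j(·, i1)‖^{2(s₀−s)}·F r w`, `hpres` from `hread` + FILE 18's sum clause.
[cite: Shimura1997, §16.4, §18.4] [cite: KudlaRallis1994, §1–§2] [cite: Tan1999, §1, §3] [cite: BorelJacquet1979, §4.1] -/
theorem exists_frames_archWhittakerIntegral_eq_of_std (hdV0 : ∀ i, dV i ≠ 0) (hdW0 : ∀ i, dW i ≠ 0)
    {χ : HeckeCharacter L} {t : InfinitePlace L → ℤ} (ht : χ.HasUnitaryArchType t 0)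
    (𝒦' : IwasawaDatum L e dV hdV dW hdW) (h𝒦' : 𝒦'.IsStd) (s₀ : ℂ) {m : ℕ}
    (A : Fin m → UnitaryGroup.arch (Fp L) L (IsCMField.complexConj L) (2 + 2) (hermD L e dV hdV dW hdW) → ℂ)
    (hAlaw : ∀ j, ∀ p : HA L e dV hdV dW hdW, IsSiegelDelta L e dV hdV dW hdW p → UnitaryGroup.finPart (Fp L) L (IsCMField.complexConj L) (2 + 2) (hermD L e dV hdV dW hdW) p = 1 →
      ∀ x : UnitaryGroup.arch (Fp L) L (IsCMField.complexConj L) (2 + 2) (hermD L e dV hdV dW hdW),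
        A j (UnitaryGroup.archPart (Fp L) L (IsCMField.complexConj L) (2 + 2) (hermD L e dV hdV dW hdW) p * x) = siegelDeltaCharacter L e dV hdV dW hdW χ s₀ p * A j x)
    (hfin : ∀ j, ∃ V : Submodule ℂ (UnitaryGroup.arch (Fp L) L (IsCMField.complexConj L) (2 + 2) (hermD L e dV hdV dW hdW) → ℂ), FiniteDimensional ℂ V ∧ A j ∈ V ∧
      ∀ a₀ : UnitaryGroup.arch (Fp L) L (IsCMField.complexConj L) (2 + 2) (hermD L e dV hdV dW hdW),
        (UnitaryGroup.archToAdelic (Fp L) L (IsCMField.complexConj L) (2 + 2) (hermD L e dV hdV dW hdW) a₀ : HA L e dV hdV dW hdW) ∈ 𝒦'.K → ∀ G ∈ V, (fun x => G (x * a₀)) ∈ V)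
    (hAc : ∀ j, Continuous (A j))
    (FinfT : Fin m → skewMatrices ((IsCMField.complexConj L : L ≃ₐ[Fp L] L) : L →+* L) ((gramR L e dV hdV dW hdW).map (algebraMap (Fp L) L)) →
      HA L e dV hdV dW hdW → ℂ → UnitaryGroup.arch (Fp L) L (IsCMField.complexConj L) (2 + 2) (hermD L e dV hdV dW hdW) → ℂ)
    (hread : ∀ (S : skewMatrices ((IsCMField.complexConj L : L ≃ₐ[Fp L] L) : L →+* L) ((gramR L e dV hdV dW hdW).map (algebraMap (Fp L) L)))
      (h : HA L e dV hdV dW hdW) (s : ℂ) (j : Fin m) (a : UnitaryGroup.arch (Fp L) L (IsCMField.complexConj L) (2 + 2) (hermD L e dV hdV dW hdW)),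
      FinfT j S h s a =
        (((modDelta L e dV hdV dW hdW (𝒦'.pPart (UnitaryGroup.archToAdelic (Fp L) L (IsCMField.complexConj L) (2 + 2) (hermD L e dV hdV dW hdW) a)) : ℝ) : ℂ) ^
            (2 * (s - s₀))) * A j a)
    (T₀ : Finset (HeightOneSpectrum (𝓞 (Fp L))))
    (νinf : Finset (HeightOneSpectrum (𝓞 (Fp L))) → Measure ↥(unipDeltaArch L e dV hdV dW hdW)) [∀ T' : Finset (HeightOneSpectrum (𝓞 (Fp L))), (νinf T').IsHaarMeasure] :
    ∃ (T Tinv : {w : InfinitePlace L // w.IsComplex} → Matrix (Fin 2 ⊕ Fin 2) (Fin 2 ⊕ Fin 2) ℂ)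
      (Fr : UnitaryGroup.arch (Fp L) L (IsCMField.complexConj L) (2 + 2) (hermD L e dV hdV dW hdW) →
        {w : InfinitePlace L // w.IsComplex} → Matrix (Fin 2 ⊕ Fin 2) (Fin 2 ⊕ Fin 2) ℂ)
      (B C : {w : InfinitePlace L // w.IsComplex} → Matrix (Fin 2) (Fin 2) ℂ)
      (g : UnitaryGroup.arch (Fp L) L (IsCMField.complexConj L) (2 + 2) (hermD L e dV hdV dW hdW))
      (m' : Fin m → ℕ) (c : ∀ j : Fin m, Fin (m' j) → ℂ) (Q : ∀ j : Fin m, Fin (m' j) → {w : InfinitePlace L // w.IsComplex} → Carrier)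
      (cν : Measure ↥(unipDeltaArch L e dV hdV dW hdW) → ℝ≥0),
      (∀ w, T w = fromBlocks (diagonal (fun k => (Real.sqrt (|(w.1.embedding (dV (e.symm k).1 * dW (e.symm k).2)).re| / 2) : ℂ))) (diagonal (fun k => (Real.sqrt (|(w.1.embedding (dV (e.symm k).1 * dW (e.symm k).2)).re| / 2) : ℂ)))
          (diagonal (fun k => I * ((((w.1.embedding (dV (e.symm k).1 * dW (e.symm k).2)).re / |(w.1.embedding (dV (e.symm k).1 * dW (e.symm k).2)).re|) * Real.sqrt (|(w.1.embedding (dV (e.symm k).1 * dW (e.symm k).2)).re| / 2) : ℝ) : ℂ))) (-diagonal (fun k => I * ((((w.1.embedding (dV (e.symm k).1 * dW (e.symm k).2)).re / |(w.1.embedding (dV (e.symm k).1 * dW (e.symm k).2)).re|) * Real.sqrt (|(w.1.embedding (dV (e.symm k).1 * dW (e.symm k).2)).re| / 2) : ℝ) : ℂ)))) ∧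
      (∀ w, Tinv w = fromBlocks (diagonal (fun k => (((Real.sqrt (|(w.1.embedding (dV (e.symm k).1 * dW (e.symm k).2)).re| / 2))⁻¹ / 2 : ℝ) : ℂ))) (-diagonal (fun k => I * (((Real.sqrt (|(w.1.embedding (dV (e.symm k).1 * dW (e.symm k).2)).re| / 2))⁻¹ * ((w.1.embedding (dV (e.symm k).1 * dW (e.symm k).2)).re / |(w.1.embedding (dV (e.symm k).1 * dW (e.symm k).2)).re|) / 2 : ℝ) : ℂ)))
          (diagonal (fun k => (((Real.sqrt (|(w.1.embedding (dV (e.symm k).1 * dW (e.symm k).2)).re| / 2))⁻¹ / 2 : ℝ) : ℂ))) (diagonal (fun k => I * (((Real.sqrt (|(w.1.embedding (dV (e.symm k).1 * dW (e.symm k).2)).re| / 2))⁻¹ * ((w.1.embedding (dV (e.symm k).1 * dW (e.symm k).2)).re / |(w.1.embedding (dV (e.symm k).1 * dW (e.symm k).2)).re|) / 2 : ℝ) : ℂ)))) ∧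
      (∀ a w, Fr a w = T w * Matrix.reindex (e₂ (n := 2)).symm (e₂ (n := 2)).symm
        (((UnitaryGroup.archAt (Fp L) L (IsCMField.complexConj L) (2 + 2) (hermD L e dV hdV dW hdW) w
          (UnitaryGroup.complexConj_smul_infinitePlace L w.1) (IsCMField.complexConj_ne_one L) a :
            UnitaryGroup.archLocal L (2 + 2) (hermD L e dV hdV dW hdW) w) : GL (Fin (2 + 2)) ℂ) : Matrix (Fin (2 + 2)) (Fin (2 + 2)) ℂ) * Tinv w) ∧
      (∀ w, T w * Tinv w = 1) ∧ (∀ w, Tinv w * T w = 1) ∧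
      (∀ w (g : GL (Fin (2 + 2)) ℂ), g ∈ UnitaryGroup.archLocal L (2 + 2) (hermD L e dV hdV dW hdW) w →
        (T w * Matrix.reindex (e₂ (n := 2)).symm (e₂ (n := 2)).symm (g : Matrix _ _ ℂ) * Tinv w)ᴴ * Matrix.J (Fin 2) ℂ *
          (T w * Matrix.reindex (e₂ (n := 2)).symm (e₂ (n := 2)).symm (g : Matrix _ _ ℂ) * Tinv w) = Matrix.J (Fin 2) ℂ) ∧
      (∀ w (g : GL (Fin (2 + 2)) ℂ), IsSiegelM (n := 2) (g : Matrix (Fin (2 + 2)) (Fin (2 + 2)) ℂ) →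
        (T w * Matrix.reindex (e₂ (n := 2)).symm (e₂ (n := 2)).symm (g : Matrix _ _ ℂ) * Tinv w).toBlocks₂₁ = 0) ∧
      (∀ w (u : GL (Fin (2 + 2)) ℂ), u ∈ UnitaryGroup.archLocal L (2 + 2) (hermD L e dV hdV dW hdW) w →
        K2LiuSiegelUnipotentLocalDefs.IsUnipM (n := 2) (u : Matrix (Fin (2 + 2)) (Fin (2 + 2)) ℂ) →
          ∃ b : Matrix (Fin 2) (Fin 2) ℂ, bᴴ = b ∧ T w * Matrix.reindex (e₂ (n := 2)).symm (e₂ (n := 2)).symm (u : Matrix _ _ ℂ) * Tinv w = fromBlocks 1 b 0 1) ∧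
      (∀ w (b : Matrix (Fin 2) (Fin 2) ℂ), bᴴ = b → ∃ u : GL (Fin (2 + 2)) ℂ,
        u ∈ UnitaryGroup.archLocal L (2 + 2) (hermD L e dV hdV dW hdW) w ∧ K2LiuSiegelUnipotentLocalDefs.IsUnipM (n := 2) (u : Matrix (Fin (2 + 2)) (Fin (2 + 2)) ℂ) ∧
          T w * Matrix.reindex (e₂ (n := 2)).symm (e₂ (n := 2)).symm (u : Matrix _ _ ℂ) * Tinv w = fromBlocks 1 b 0 1) ∧
      (∀ w (P : Matrix (Fin 2 ⊕ Fin 2) (Fin 2 ⊕ Fin 2) ℂ), Pᴴ * Matrix.J (Fin 2) ℂ * P = Matrix.J (Fin 2) ℂ →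
        ∃ g : GL (Fin (2 + 2)) ℂ, g ∈ UnitaryGroup.archLocal L (2 + 2) (hermD L e dV hdV dW hdW) w ∧
          T w * Matrix.reindex (e₂ (n := 2)).symm (e₂ (n := 2)).symm (g : Matrix _ _ ℂ) * Tinv w = P) ∧
      (∀ w, T w * fromBlocks 1 0 0 (-1) * Tinv w = fromBlocks 0 (B w) (C w) 0) ∧ (∀ w, IsUnit (C w).det) ∧
      (∀ k : UnitaryGroup.arch (Fp L) L (IsCMField.complexConj L) (2 + 2) (hermD L e dV hdV dW hdW),
        (∀ w, moeb (Fr k w) (I • (1 : Matrix (Fin 2) (Fin 2) ℂ)) = I • 1) →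
          (UnitaryGroup.archToAdelic (Fp L) L (IsCMField.complexConj L) (2 + 2) (hermD L e dV hdV dW hdW) (g * k * g⁻¹) : HA L e dV hdV dW hdW) ∈ 𝒦'.K) ∧
      ∀ eb : skewMatrices ((IsCMField.complexConj L : L ≃ₐ[Fp L] L) : L →+* L) ((gramR L e dV hdV dW hdW).map (algebraMap (Fp L) L)) → HA L e dV hdV dW hdW →
      {w : InfinitePlace L // w.IsComplex} → Matrix (Fin 2) (Fin 2) ℂ → ℂ,
        (∀ (S : skewMatrices ((IsCMField.complexConj L : L ≃ₐ[Fp L] L) : L →+* L) ((gramR L e dV hdV dW hdW).map (algebraMap (Fp L) L)))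
      (h : HA L e dV hdV dW hdW) (u : ↥(unipDeltaArch L e dV hdV dW hdW)),
      (conj (unipDeltaChar L e dV hdV dW hdW (S : Matrix (Fin 2) (Fin 2) L)
          (UnitaryGroup.archToAdelic (Fp L) L (IsCMField.complexConj L) (2 + 2) (hermD L e dV hdV dW hdW)
            (u : UnitaryGroup.arch (Fp L) L (IsCMField.complexConj L) (2 + 2) (hermD L e dV hdV dW hdW))) : ℂ)) =
        ∏ w, eb S h w (Matrix.toBlocks₁₂ (Fr (u : UnitaryGroup.arch (Fp L) L (IsCMField.complexConj L) (2 + 2) (hermD L e dV hdV dW hdW)) w))) →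
      ∀ Ew : (∀ j : Fin m, Fin (m' j) → skewMatrices ((IsCMField.complexConj L : L ≃ₐ[Fp L] L) : L →+* L) ((gramR L e dV hdV dW hdW).map (algebraMap (Fp L) L)) →
        HA L e dV hdV dW hdW → {w : InfinitePlace L // w.IsComplex} → ℂ → ℂ),
        (∀ (j : Fin m) (r : Fin (m' j)) (S : skewMatrices ((IsCMField.complexConj L : L ≃ₐ[Fp L] L) : L →+* L) ((gramR L e dV hdV dW hdW).map (algebraMap (Fp L) L)))
          (h : HA L e dV hdV dW hdW) (w : {w : InfinitePlace L // w.IsComplex}), (S : Matrix (Fin 2) (Fin 2) L).det ≠ 0 → ∀ s : ℂ, ((2 : ℕ) : ℝ) / 2 < s.re →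
          ∀ F : Matrix (Fin 2 ⊕ Fin 2) (Fin 2 ⊕ Fin 2) ℂ → ℂ, IsArchSiegelSection (fun z : ℂ => (conj z / ((‖z‖ : ℝ) : ℂ)) ^ (-(t w.1))) s F →
            (∀ (v : Matrix (Fin 2) (Fin 2) ℂ), vᴴ * v = 1 → ∀ hv : v.det ≠ 0,
              F ((2 : ℂ)⁻¹ • fromBlocks (1 + v) (-(I • (1 - v))) (I • (1 - v)) (1 + v) : Matrix (Fin 2 ⊕ Fin 2) (Fin 2 ⊕ Fin 2) ℂ) = evalAt v hv (Q j r w)) →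
            ∫ x : Fin 2 → Fin 2 → ℝ, F ((fromBlocks 0 (B w) (C w) 0 : Matrix (Fin 2 ⊕ Fin 2) (Fin 2 ⊕ Fin 2) ℂ) * fromBlocks 1 (hermOfReal x) 0 1 *
                Fr (UnitaryGroup.archPart (Fp L) L (IsCMField.complexConj L) (2 + 2) (hermD L e dV hdV dW hdW) h * g) w) *
              eb S h w (hermOfReal x) = Ew j r S h w s) →
        ∀ (j : Fin m) (S : skewMatrices ((IsCMField.complexConj L : L ≃ₐ[Fp L] L) : L →+* L) ((gramR L e dV hdV dW hdW).map (algebraMap (Fp L) L)))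
          (h : HA L e dV hdV dW hdW), (S : Matrix (Fin 2) (Fin 2) L).det ≠ 0 → ∀ s : ℂ, ((2 : ℕ) : ℝ) / 2 < s.re →
          archWhittakerIntegral L e dV hdV dW hdW (νinf (kindWFinset L e dV hdV dW hdW T₀ (S : Matrix (Fin 2) (Fin 2) L) h)) (S : Matrix (Fin 2) (Fin 2) L)
              (FinfT j S h) (UnitaryGroup.archPart (Fp L) L (IsCMField.complexConj L) (2 + 2) (hermD L e dV hdV dW hdW) h) s =
            (((modDelta L e dV hdV dW hdW (𝒦'.pPart (UnitaryGroup.archToAdelic (Fp L) L (IsCMField.complexConj L) (2 + 2) (hermD L e dV hdV dW hdW) g⁻¹)) : ℝ) : ℂ) ^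
                (2 * (s - s₀))) *
              ∑ r, c j r * ((((cν (νinf (kindWFinset L e dV hdV dW hdW T₀ (S : Matrix (Fin 2) (Fin 2) L) h))) : ℝ) : ℂ) * ∏ w, Ew j r S h w s) := by
  -- ★ p863520 §3's preamble, verbatim: the tube frames of record (★ arch₄) `choose`n once, their anti-diagonal reading, the Shimura invertibility
  choose T Tinv h1 h2 hTU hTS hTiv hTN hTV hW hTdef hTinvdef using fun w : {w : InfinitePlace L // w.IsComplex} =>
    exists_tubeFrame_arch₄ L e dV hdV dW hdW w (UnitaryGroup.complexConj_smul_infinitePlace L w.1) hdV0 hdW0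
  choose B C hCu hBC using hW
  have hDC := fun w : {w : InfinitePlace L // w.IsComplex} => isUnit_det_shimuraFrame (n := 2)
    (fun k => (w.1.embedding (dV (e.symm k).1 * dW (e.symm k).2)).re)
    (tw_ne_zero L e dV hdV dW hdW w (UnitaryGroup.complexConj_smul_infinitePlace L w.1) hdV0 hdW0)
  obtain ⟨Fr, hFr⟩ : ∃ Fr : UnitaryGroup.arch (Fp L) L (IsCMField.complexConj L) (2 + 2) (hermD L e dV hdV dW hdW) → {w : InfinitePlace L // w.IsComplex} → Matrix (Fin 2 ⊕ Fin 2) (Fin 2 ⊕ Fin 2) ℂ,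
      ∀ k w, Fr k w = T w * Matrix.reindex (e₂ (n := 2)).symm (e₂ (n := 2)).symm (((UnitaryGroup.archAt (Fp L) L (IsCMField.complexConj L) (2 + 2) (hermD L e dV hdV dW hdW) w (UnitaryGroup.complexConj_smul_infinitePlace L w.1) (IsCMField.complexConj_ne_one L) k : UnitaryGroup.archLocal L (2 + 2) (hermD L e dV hdV dW hdW) w) : GL (Fin (2 + 2)) ℂ) : Matrix (Fin (2 + 2)) (Fin (2 + 2)) ℂ) * Tinv w :=
    ⟨_, fun _ _ => rfl⟩
  -- reading frames
  obtain ⟨fr, hfrM, hfrc, -⟩ := exists_readingFrame L e dV hdV dW hdW hdV0 hdW0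
  have hfrτ : ∀ w (u : Matrix.unitaryGroup (Fin 2) ℂ),
      T w * Matrix.reindex (e₂ (n := 2)).symm (e₂ (n := 2)).symm (((fr w u : UnitaryGroup.archLocal L (2 + 2) (hermD L e dV hdV dW hdW) w) : GL (Fin (2 + 2)) ℂ) :
        Matrix (Fin (2 + 2)) (Fin (2 + 2)) ℂ) * Tinv w =
      (2 : ℂ)⁻¹ • fromBlocks (1 + (u : Matrix (Fin 2) (Fin 2) ℂ)) (-(I • (1 - (u : Matrix (Fin 2) (Fin 2) ℂ)))) (I • (1 - (u : Matrix (Fin 2) (Fin 2) ℂ))) (1 + (u : Matrix (Fin 2) (Fin 2) ℂ)) := by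
    intro w u
    have hG := hfrM w u
    rw [← hTdef w, ← hTinvdef w] at hG
    rw [tube_eq_of_chart_formula (T w) (Tinv w) (h1 w) hG, kappa_eq]
  -- the conjugator of ★ FILE 21 for the standard datum, read in the frame
  obtain ⟨g, hg⟩ := exists_frameCompact_conjugator L e dV hdV hdV0 dW hdW hdW0 h𝒦' T Tinv hTdef hTinvdef
  have hg' : ∀ k : UnitaryGroup.arch (Fp L) L (IsCMField.complexConj L) (2 + 2) (hermD L e dV hdV dW hdW), (∀ w, moeb (Fr k w) (I • (1 : Matrix (Fin 2) (Fin 2) ℂ)) = I • 1) →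
      (UnitaryGroup.archToAdelic (Fp L) L (IsCMField.complexConj L) (2 + 2) (hermD L e dV hdV dW hdW) (g * k * g⁻¹) : HA L e dV hdV dW hdW) ∈ 𝒦'.K :=
    fun k hk => hg k fun w => by rw [← hFr]; exact hk w
  -- ★ FILE 18's flat tube presentation, `choose`n ONCE per summand `j`
  have hflat := fun j : Fin m => exists_flat_tube_presentation L e dV hdV hdV0 dW hdW hdW0 T Tinv Fr hFr h1 h2 hTU hTS hTV
    (fun w => diagonal fun k => (Real.sqrt (|(w.1.embedding (dV (e.symm k).1 * dW (e.symm k).2)).re| / 2) : ℂ))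
    (fun w => diagonal fun k => I * ((((w.1.embedding (dV (e.symm k).1 * dW (e.symm k).2)).re / |(w.1.embedding (dV (e.symm k).1 * dW (e.symm k).2)).re|) *
      Real.sqrt (|(w.1.embedding (dV (e.symm k).1 * dW (e.symm k).2)).re| / 2) : ℝ) : ℂ))
    hTdef (fun w => (hDC w).1) (fun w => (hDC w).2) fr hfrc hfrτ 𝒦' g hg' ht s₀
    (isArchSiegelDeltaSection_of_finPart_eq_one L e dV hdV dW hdW (hAlaw j)) (hfin j) (hAc j)
  choose mr c Q F hF hQ hsum using hflat
  -- ★ p864162's ratio function of the carrier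
  obtain ⟨cν, hcν⟩ := exists_haarRatio_archWhittakerIntegral_eq L e dV hdV dW hdW T Tinv Fr hFr h2 hTU h1 hTiv hTN
  refine ⟨T, Tinv, Fr, B, C, g, mr, c, Q, cν, hTdef, hTinvdef, hFr, h1, h2, hTU, hTS, hTiv, hTN, hTV, hBC, hCu, hg', fun eb heb Ew hEwq j S h hS s hs => ?_⟩
  have hs₁ : (1 : ℝ) / 2 ≤ ((2 : ℕ) : ℝ) / 2 := by norm_num
  exact hcν (νinf (kindWFinset L e dV hdV dW hdW T₀ (S : Matrix (Fin 2) (Fin 2) L) h)) B C hBC (fun w => -(t w.1)) (S : Matrix (Fin 2) (Fin 2) L) (eb S h) (heb S h)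
    (UnitaryGroup.archPart (Fp L) L (IsCMField.complexConj L) (2 + 2) (hermD L e dV hdV dW hdW) h) g (c j) (Q j) (((2 : ℕ) : ℝ) / 2) hs₁
    (fun r w => Ew j r S h w) (fun r w s' hs' F' hF' hF'Q => hEwq j r S h w hS s' hs' F' hF' hF'Q) (FinfT j S h)
    (fun s' => (((modDelta L e dV hdV dW hdW (𝒦'.pPart (UnitaryGroup.archToAdelic (Fp L) L (IsCMField.complexConj L) (2 + 2) (hermD L e dV hdV dW hdW) g⁻¹)) : ℝ) : ℂ) ^
      (2 * (s' - s₀))))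
    (fun s' r w x => (((‖(denom x (I • (1 : Matrix (Fin 2) (Fin 2) ℂ))).det‖ : ℝ) : ℂ) ^ (2 * (s₀ - s'))) * F j r w x)
    (fun s' _ r w => (hF j) s' r w) (fun s' _ r w => (hQ j) s' r w) (fun s' _ a => by rw [hread S h s' j a, (hsum j) s' a]) s hs

end Summit.HodgeConjecture.HodgeConjecture.Cruxes.HLiu418.K2LiuKindWArchContinuationExplicitOfRecord

end
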